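import Summits.CriticalPhenomena.Ising3DConformalLimit.Theses.MirrorHoelderCompactness
import Summits.CriticalPhenomena.Ising3DConformalLimit.Theorems.EnergyNotSigmaSquaredMoebiusLimitExistsLocallyBounded
import Literature.Probability.LatticeModels.TwoPointSupNormMonotone
import Literature.Probability.LatticeModels.PointwiseScalingLimitTwoPointMono
import Literature.Probability.LatticeModels.PointwiseScalingLimitDiscreteScaleInvariance
import Summits.CriticalPhenomena.Ising3DConformalLimit.Theorems.MoebiusLimitExists.Negative.PinnedClusterPoints
import HarnessLib

/-!
# Route MirrorHoelderCompactness — `RescaledBounds` (item stmt-CriticalPhenomena-6157)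

Two-point spine ⇒ local bounds, conditional on all-scale doubling (D). With the forced
renormalisation `ρ★(δ) = ⟨σ₀σ_{⌊1/δ⌋e₀}⟩_{β_c}^{-1/2}`, `F_n^δ = rescaledCorrelator (criticalCorr 3) ρ★ n δ`:
(a) for every `n` and compact `K ⊆ NonCoincident 3 n`, `|F_n^δ| ≤ M` on `K` for `δ ∈ (0, δ₀)`;
(c) for `n = 2`, `F_2^δ ≥ m > 0` on `K` for `δ ∈ (0, δ₀)` — granted `TwoPointDoubling`
(`κ g(n) ≤ g(2n)`, `n ≥ 1`, `g(n) = ⟨σ₀σ_{ne₀}⟩_{β_c}`). `rescaledBounds_proof` is literally the route decl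
`Summit.CriticalPhenomena.Ising3DConformalLimit.Theses.MirrorHoelderCompactness.RescaledBounds`.

Proof. `ρ★ = rhoPin` (the pinned renormalisation of `…MoebiusLimitExistsDefs`), so the rescaled pair
correlator is the RATIO `G(z)/g(N)`, `z = [p₁/δ] − [p₀/δ]`, `N = ⌊1/δ⌋` (`rescaledCorrelator_rhoPin_two`).
Two-point comparability: the sup-norm Messager–Miracle-Solé comparison `3‖x‖_∞ ≤ ‖y‖_∞ ⇒ G(y) ≤ G(x)`
(`twoPointPlus_le_of_mul_supNorm_le`, Aizenman–Duminil-Copin 2021 eq. (5.3)) and iterated doubling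
`κʲ g(n) ≤ g(2ʲn)` give `κʲ G(z) ≤ g(N)` when `3N ≤ 2ʲ⌊‖z‖_∞/3⌋` and `κʲ g(N) ≤ G(z)` when
`3‖z‖_∞ ≤ 2ʲN`. Floor geometry (`le_supNorm_latticeApprox_sub`, `supNorm_latticeApprox_sub_le`):
`‖p₁−p₀‖_∞/δ − 2 ≤ ‖z‖_∞ ≤ ‖p₁−p₀‖_∞/δ + 2`; on a compact set of non-coincident pairs
`0 < r ≤ ‖p₁−p₀‖_∞ ≤ R`, so with `2ʲ ≥ 18/r`, `δ < 4⁻¹2⁻ʲ` the pair zoom is `≤ κ⁻ʲ`, and with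
`2ʲ > 6R + 6`, `δ < 1/2` it is `≥ κʲ` (part (c)). Part (a): odd `n` vanish
(`criticalCorr_eq_zero_of_odd`); for `n = 2m`, Griffiths I and NEWMAN'S GAUSSIAN INEQUALITY in infinite
volume (`criticalCorr_le_pairingSum`) bound `F_{2m}^δ` by the pairing functional of the pair zooms
`ρ★²⟨σ_{[xᵢ/δ]}σ_{[xⱼ/δ]}⟩` (`i ≠ j`), each `≤ B₂` on `K` for `δ < (1 + Σ δᵢⱼ⁻¹)⁻¹` by the pair bound on
the compact pair-sets `{(xᵢ,xⱼ) : x ∈ K}`, whence `|F_{2m}^δ| ≤ (2m)! B₂ᵐ` — the template is the landed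
`pinnedZoomLocallyBounded` (sequential form, under the two-point law instead of doubling).

References: Messager–Miracle-Solé, J. Stat. Phys. 17 (1977) 245; Aizenman–Duminil-Copin, Ann. Math.
194 (2021) = arXiv:1912.07973, §5.1 eq. (5.3), §6.3; Newman, Z. Wahrsch. 33 (1975) 75; Aizenman,
Comm. Math. Phys. 86 (1982) 1. No definitions are introduced.
-/

noncomputable section

open Filter Topology Set Function
open Literature.Probability.LatticeModels
open Summit.CriticalPhenomena.Ising3DConformalLimit.MoebiusLimitExistsOnlyInteraction
open Summit.CriticalPhenomena.Ising3DConformalLimit.PinnedClusterPoints (criticalTwoPoint_pos3)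
open Summit.CriticalPhenomena.Ising3DConformalLimit.Theses.MirrorHoelderCompactness (TwoPointDoubling
  RescaledBounds)

namespace Summit.CriticalPhenomena.Ising3DConformalLimit.MirrorHoelderCompactnessRescaledBounds

/-! ### The forced renormalisation is the pinned one; two-point comparability -/

/-- The route's forced renormalisation `δ ↦ ⟨σ₀σ_{⌊δ⁻¹⌋e₀}⟩_{β_c}^{-1/2}` is the pinned
renormalisation `rhoPin` (`⌊δ⁻¹⌋ = ⌊1/δ⌋`). [folklore] -/
theorem rhoStar_eq_rhoPin :
    (fun δ : ℝ => (criticalTwoPoint 3 (Pi.single 0 ⌊δ⁻¹⌋)) ^ (-(1/2:ℝ))) = rhoPin := by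
  funext δ
  simp [rhoPin, one_div]

/-- **MMS comparison in the sup norm at `β_c` on `ℤ³`** (Aizenman–Duminil-Copin 2021, eq. (5.3)):
`3‖x‖_∞ ≤ ‖y‖_∞ ⇒ ⟨σ₀σ_y⟩_{β_c} ≤ ⟨σ₀σ_x⟩_{β_c}`.
[cite: AizenmanDuminilCopinAnnals2021, arXiv:1912.07973 §5.1, eq. (5.3)] -/
theorem criticalTwoPoint_le_of_supNorm {x y : Site 3} (h : 3 * Site.supNorm x ≤ Site.supNorm y) :
    criticalTwoPoint 3 y ≤ criticalTwoPoint 3 x :=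
  twoPointPlus_le_of_mul_supNorm_le (criticalBeta_nonneg 3) h

/-- **Iterated doubling**: `κʲ g(n) ≤ g(2ʲ n)` for `n ≥ 1`, `g(n) = ⟨σ₀σ_{ne₀}⟩_{β_c}`, from the
one-step doubling `κ g(n) ≤ g(2n)`. [folklore] -/
theorem doubling_iter {κ : ℝ} (hκ : 0 < κ)
    (hD : ∀ n : ℕ, 1 ≤ n → κ * criticalTwoPoint 3 (Pi.single 0 (n : ℤ)) ≤
      criticalTwoPoint 3 (Pi.single 0 (2 * (n : ℤ))))
    (j n : ℕ) (hn : 1 ≤ n) :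
    κ ^ j * criticalTwoPoint 3 (Pi.single 0 (n : ℤ)) ≤
      criticalTwoPoint 3 (Pi.single 0 ((2 ^ j * n : ℕ) : ℤ)) := by
  induction j with
  | zero => simp
  | succ j ih =>
    have h2 := hD (2 ^ j * n) (Nat.one_le_iff_ne_zero.2 (Nat.mul_ne_zero (by positivity) (by omega)))
    have hcast : (2 * ((2 ^ j * n : ℕ) : ℤ)) = ((2 ^ (j + 1) * n : ℕ) : ℤ) := by
      push_cast
      ring
    rw [hcast] at h2
    calc κ ^ (j + 1) * criticalTwoPoint 3 (Pi.single 0 (n : ℤ))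
        = κ * (κ ^ j * criticalTwoPoint 3 (Pi.single 0 (n : ℤ))) := by ring
      _ ≤ κ * criticalTwoPoint 3 (Pi.single 0 ((2 ^ j * n : ℕ) : ℤ)) :=
        mul_le_mul_of_nonneg_left ih hκ.le
      _ ≤ criticalTwoPoint 3 (Pi.single 0 ((2 ^ (j + 1) * n : ℕ) : ℤ)) := h2

/-- **Upper comparison**: if `1 ≤ m₁`, `3m₁ ≤ ‖z‖_∞` and `3N ≤ 2ʲ m₁` then `κʲ G(z) ≤ g(N)`
(`G(z) ≤ g(m₁)` and `g(2ʲm₁) ≤ g(N)` by MMS, `κʲ g(m₁) ≤ g(2ʲ m₁)` by doubling). [folklore] -/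
theorem pow_mul_criticalTwoPoint_le_axis {κ : ℝ} (hκ : 0 < κ)
    (hD : ∀ n : ℕ, 1 ≤ n → κ * criticalTwoPoint 3 (Pi.single 0 (n : ℤ)) ≤
      criticalTwoPoint 3 (Pi.single 0 (2 * (n : ℤ))))
    {z : Site 3} {N m₁ j : ℕ} (hm₁ : 1 ≤ m₁) (hz : 3 * m₁ ≤ Site.supNorm z)
    (hN : 3 * N ≤ 2 ^ j * m₁) :
    κ ^ j * criticalTwoPoint 3 z ≤ criticalTwoPoint 3 (Pi.single 0 (N : ℤ)) := by
  have hsn : ∀ n : ℕ, Site.supNorm (Pi.single (0 : Fin 3) (n : ℤ) : Site 3) = n := fun n => by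
    rw [Site.supNorm_single, Int.natAbs_natCast]
  have h1 : criticalTwoPoint 3 z ≤ criticalTwoPoint 3 (Pi.single 0 (m₁ : ℤ)) :=
    criticalTwoPoint_le_of_supNorm (by rwa [hsn])
  have h3 : criticalTwoPoint 3 (Pi.single 0 ((2 ^ j * m₁ : ℕ) : ℤ)) ≤
      criticalTwoPoint 3 (Pi.single 0 (N : ℤ)) :=
    criticalTwoPoint_le_of_supNorm (by rwa [hsn, hsn])
  calc κ ^ j * criticalTwoPoint 3 z ≤ κ ^ j * criticalTwoPoint 3 (Pi.single 0 (m₁ : ℤ)) :=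
        mul_le_mul_of_nonneg_left h1 (pow_nonneg hκ.le j)
    _ ≤ criticalTwoPoint 3 (Pi.single 0 ((2 ^ j * m₁ : ℕ) : ℤ)) := doubling_iter hκ hD j m₁ hm₁
    _ ≤ criticalTwoPoint 3 (Pi.single 0 (N : ℤ)) := h3

/-- **Lower comparison**: if `1 ≤ N` and `3‖z‖_∞ ≤ 2ʲ N` then `κʲ g(N) ≤ G(z)`
(`κʲ g(N) ≤ g(2ʲ N)` by doubling, `g(2ʲN) ≤ G(z)` by MMS). [folklore] -/
theorem pow_mul_axis_le_criticalTwoPoint {κ : ℝ} (hκ : 0 < κ)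
    (hD : ∀ n : ℕ, 1 ≤ n → κ * criticalTwoPoint 3 (Pi.single 0 (n : ℤ)) ≤
      criticalTwoPoint 3 (Pi.single 0 (2 * (n : ℤ))))
    {z : Site 3} {N j : ℕ} (hN : 1 ≤ N) (hz : 3 * Site.supNorm z ≤ 2 ^ j * N) :
    κ ^ j * criticalTwoPoint 3 (Pi.single 0 (N : ℤ)) ≤ criticalTwoPoint 3 z := by
  have hsn : Site.supNorm (Pi.single (0 : Fin 3) ((2 ^ j * N : ℕ) : ℤ) : Site 3) = 2 ^ j * N := by
    rw [Site.supNorm_single, Int.natAbs_natCast]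
  exact (doubling_iter hκ hD j N hN).trans (criticalTwoPoint_le_of_supNorm (by rwa [hsn]))

/-- For `0 < δ` there is `N : ℕ` with `⌊1/δ⌋ = N`, `N ≤ 1/δ < N + 1`. [folklore] -/
theorem exists_floor_eq {δ : ℝ} (hδ : 0 < δ) :
    ∃ N : ℕ, (⌊1 / δ⌋ : ℤ) = N ∧ (N : ℝ) ≤ 1 / δ ∧ 1 / δ < N + 1 := by
  obtain ⟨N, hN⟩ := Int.eq_ofNat_of_zero_le (Int.floor_nonneg.2 (by positivity : (0 : ℝ) ≤ 1 / δ))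
  have h1 := Int.floor_le (1 / δ)
  have h2 := Int.lt_floor_add_one (1 / δ)
  rw [hN] at h1 h2
  exact ⟨N, hN, by exact_mod_cast h1, by exact_mod_cast h2⟩

/-! ### The pair zoom on compact sets of pairs -/

/-- The sup-norm distance of a pair, `p ↦ ‖p₁ − p₀‖_∞`, is continuous. [folklore] -/
theorem continuous_pairDist :
    Continuous fun p : Fin 2 → EuclideanSpace ℝ (Fin 3) => ‖WithLp.ofLp (p 1) - WithLp.ofLp (p 0)‖ := by
  have h : ∀ i : Fin 2, Continuous fun p : Fin 2 → EuclideanSpace ℝ (Fin 3) => WithLp.ofLp (p i) :=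
    fun i => (PiLp.continuous_ofLp 2 _).comp (continuous_apply i)
  exact ((h 1).sub (h 0)).norm

/-- A compact set of non-coincident pairs has a positive lower bound on the pair distances
(`supDist_pos` at a minimiser). [folklore] -/
theorem exists_pos_le_pairDist {P : Set (Fin 2 → EuclideanSpace ℝ (Fin 3))} (hP : IsCompact P)
    (hPs : P ⊆ NonCoincident 3 2) :
    ∃ r : ℝ, 0 < r ∧ ∀ p ∈ P, r ≤ ‖WithLp.ofLp (p 1) - WithLp.ofLp (p 0)‖ := by
  rcases P.eq_empty_or_nonempty with hPe | hPne
  · exact ⟨1, one_pos, fun p hp => by simp [hPe] at hp⟩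
  · obtain ⟨p₀, hp₀, hmin⟩ := hP.exists_isMinOn hPne continuous_pairDist.continuousOn
    exact ⟨_, supDist_pos (hPs hp₀), fun p hp => hmin hp⟩

/-- A compact set of pairs has a finite upper bound on the pair distances. [folklore] -/
theorem exists_pairDist_le {P : Set (Fin 2 → EuclideanSpace ℝ (Fin 3))} (hP : IsCompact P) :
    ∃ R : ℝ, 0 ≤ R ∧ ∀ p ∈ P, ‖WithLp.ofLp (p 1) - WithLp.ofLp (p 0)‖ ≤ R := by
  obtain ⟨R, hR⟩ := hP.bddAbove_image continuous_pairDist.continuousOn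
  exact ⟨max R 0, le_max_right _ _, fun p hp => (hR (Set.mem_image_of_mem _ hp)).trans (le_max_left _ _)⟩

/-- **Upper bound for the pinned pair zoom under doubling.** On a compact set `P` of non-coincident
pairs the pinned rescaled pair correlators `ρ★(δ)² ⟨σ_{[p₀/δ]}σ_{[p₁/δ]}⟩_{β_c} = G(z)/g(N)` are
`≤ κ⁻ʲ` for all `δ < 4⁻¹2⁻ʲ`, where `2ʲ ≥ 18/r`, `r` the least pair distance on `P`: then
`N = ⌊1/δ⌋ ≥ 2ʲ⁺²`, `‖z‖_∞ ≥ rN − 2`, so `m₁ = ⌊‖z‖_∞/3⌋` has `3N ≤ 2ʲ m₁` and the upper comparison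
applies. [folklore] -/
theorem pair_upper {κ : ℝ} (hκ : 0 < κ)
    (hD : ∀ n : ℕ, 1 ≤ n → κ * criticalTwoPoint 3 (Pi.single 0 (n : ℤ)) ≤
      criticalTwoPoint 3 (Pi.single 0 (2 * (n : ℤ))))
    {P : Set (Fin 2 → EuclideanSpace ℝ (Fin 3))} (hP : IsCompact P) (hPs : P ⊆ NonCoincident 3 2) :
    ∃ B δ₀ : ℝ, 0 < δ₀ ∧ ∀ δ ∈ Set.Ioo 0 δ₀, ∀ p ∈ P,
      rescaledCorrelator (criticalCorr 3) rhoPin 2 δ p ≤ B := by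
  obtain ⟨r, hr, hrle⟩ := exists_pos_le_pairDist hP hPs
  -- the comparison depth `j`: `18 / r < 2^j`
  obtain ⟨j, hj⟩ := exists_nat_gt (18 / r)
  have hT : (18 : ℝ) / r < (2 : ℝ) ^ j := hj.trans (by exact_mod_cast Nat.lt_two_pow_self)
  have hT0 : (0 : ℝ) < (2 : ℝ) ^ j := by positivity
  have hTr : (18 : ℝ) ≤ 2 ^ j * r := by
    have := (div_lt_iff₀ hr).1 hT
    linarith
  refine ⟨(κ ^ j)⁻¹, ((2 : ℝ) ^ (j + 2))⁻¹, by positivity, fun δ hδ p hp => ?_⟩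
  have hδ0 : 0 < δ := hδ.1
  obtain ⟨N, hNeq, hNle, hNlt⟩ := exists_floor_eq hδ0
  have hNbig : 2 ^ (j + 2) ≤ N := by
    have h1 : (2 : ℝ) ^ (j + 2) < 1 / δ := by
      rw [lt_one_div (by positivity) hδ0, one_div]
      exact hδ.2
    have h2 : ((2 ^ (j + 2) : ℕ) : ℝ) < (N : ℝ) + 1 := by
      push_cast
      linarith
    have h3 : 2 ^ (j + 2) < N + 1 := by exact_mod_cast h2
    omega
  -- the lattice displacement, its sup norm, and `m₁ = ⌊‖z‖_∞ / 3⌋`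
  set z : Site 3 := latticeApprox δ (p 1) - latticeApprox δ (p 0) with hz
  have hzlow : r * N - 2 ≤ (Site.supNorm z : ℝ) := by
    have h1 := le_supNorm_latticeApprox_sub (d := 3) (by norm_num) hδ0 (p 1) (p 0)
    have h2 : r / δ ≤ ‖WithLp.ofLp (p 1) - WithLp.ofLp (p 0)‖ / δ :=
      div_le_div_of_nonneg_right (hrle p hp) hδ0.le
    have h3 : r * N ≤ r / δ := by
      rw [le_div_iff₀ hδ0, mul_assoc]
      refine mul_le_of_le_one_right hr.le ?_
      have := (le_div_iff₀ hδ0).1 hNle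
      linarith
    linarith
  set m₁ : ℕ := Site.supNorm z / 3 with hm₁
  have hm₁le : 3 * m₁ ≤ Site.supNorm z := by omega
  have hm₁ge : Site.supNorm z ≤ 3 * m₁ + 2 := by omega
  have hkey : 3 * N ≤ 2 ^ j * m₁ := by
    have hm₁ge' : (Site.supNorm z : ℝ) ≤ 3 * m₁ + 2 := by exact_mod_cast hm₁ge
    have hNbig' : ((2 ^ (j + 2) : ℕ) : ℝ) ≤ N := by exact_mod_cast hNbig
    have hNbig'' : 4 * (2 : ℝ) ^ j ≤ N := by
      have : ((2 ^ (j + 2) : ℕ) : ℝ) = 4 * (2 : ℝ) ^ j := by push_cast; ring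
      linarith
    have hN0 : (0 : ℝ) ≤ N := by positivity
    -- `2^j (3 m₁) ≥ 2^j (r N − 4) ≥ 18 N − 4·2^j ≥ 9 N`
    have e1 : (2 : ℝ) ^ j * (r * N - 4) ≤ 2 ^ j * (3 * m₁) :=
      mul_le_mul_of_nonneg_left (by linarith) hT0.le
    have e2 : 18 * (N : ℝ) ≤ 2 ^ j * r * N := mul_le_mul_of_nonneg_right hTr hN0
    have e3 : (3 : ℝ) * N ≤ 2 ^ j * m₁ := by nlinarith
    exact_mod_cast e3
  have hm₁pos : 1 ≤ m₁ := by
    have hN1 : 1 ≤ N := le_trans Nat.one_le_two_pow hNbig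
    have : 1 ≤ 2 ^ j * m₁ := le_trans (by omega) hkey
    exact Nat.one_le_iff_ne_zero.2 fun h => by simp [h] at this
  have hcmp := pow_mul_criticalTwoPoint_le_axis hκ hD hm₁pos hm₁le hkey
  -- the ratio
  have hgN : 0 < criticalTwoPoint 3 (Pi.single 0 (N : ℤ)) := criticalTwoPoint_pos3 _
  rw [rescaledCorrelator_rhoPin_two, hNeq, div_le_iff₀ hgN]
  have hκj : 0 < κ ^ j := pow_pos hκ j
  calc criticalTwoPoint 3 z = (κ ^ j)⁻¹ * (κ ^ j * criticalTwoPoint 3 z) := by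
        field_simp
    _ ≤ (κ ^ j)⁻¹ * criticalTwoPoint 3 (Pi.single 0 (N : ℤ)) :=
        mul_le_mul_of_nonneg_left hcmp (inv_nonneg.2 hκj.le)

/-- **Lower bound for the pinned pair zoom under doubling.** On a compact set `P` of pairs
(coincidences allowed), for `δ < 1/2` the pinned rescaled pair correlators are `≥ κʲ`, where
`2ʲ > 6R + 6`, `R` the largest pair distance on `P`: `‖z‖_∞ ≤ R/δ + 2`, `N = ⌊1/δ⌋ > 1/δ − 1 ≥ 1/(2δ)`,
so `3‖z‖_∞ ≤ 2ʲ N` and the lower comparison applies. [folklore] -/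
theorem pair_lower {κ : ℝ} (hκ : 0 < κ)
    (hD : ∀ n : ℕ, 1 ≤ n → κ * criticalTwoPoint 3 (Pi.single 0 (n : ℤ)) ≤
      criticalTwoPoint 3 (Pi.single 0 (2 * (n : ℤ))))
    {P : Set (Fin 2 → EuclideanSpace ℝ (Fin 3))} (hP : IsCompact P) :
    ∃ c δ₀ : ℝ, 0 < c ∧ 0 < δ₀ ∧ ∀ δ ∈ Set.Ioo 0 δ₀, ∀ p ∈ P,
      c ≤ rescaledCorrelator (criticalCorr 3) rhoPin 2 δ p := by
  obtain ⟨R, hR0, hRle⟩ := exists_pairDist_le hP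
  obtain ⟨j, hj⟩ := exists_nat_gt (6 * R + 6)
  have hT : 6 * R + 6 < (2 : ℝ) ^ j := hj.trans (by exact_mod_cast Nat.lt_two_pow_self)
  refine ⟨κ ^ j, 1 / 2, pow_pos hκ j, by norm_num, fun δ hδ p hp => ?_⟩
  have hδ0 : 0 < δ := hδ.1
  have hδhalf : δ < 1 / 2 := hδ.2
  obtain ⟨N, hNeq, hNle, hNlt⟩ := exists_floor_eq hδ0
  -- `δ N > 1/2`, in particular `N ≥ 1`
  have hs : 1 / 2 < δ * N := by
    have h1 : 1 < δ * (N + 1) := by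
      have := (div_lt_iff₀ hδ0).1 hNlt
      linarith
    nlinarith
  have hN1 : 1 ≤ N := Nat.one_le_iff_ne_zero.2 fun h => by
    rw [h, Nat.cast_zero, mul_zero] at hs
    norm_num at hs
  -- the lattice displacement and its sup norm
  set z : Site 3 := latticeApprox δ (p 1) - latticeApprox δ (p 0) with hz
  have hzup : δ * (Site.supNorm z : ℝ) ≤ R + 2 * δ := by
    have h1 := supNorm_latticeApprox_sub_le (d := 3) hδ0 (p 1) (p 0)
    have h2 : ‖WithLp.ofLp (p 1) - WithLp.ofLp (p 0)‖ / δ ≤ R / δ :=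
      div_le_div_of_nonneg_right (hRle p hp) hδ0.le
    have h3 : (Site.supNorm z : ℝ) ≤ R / δ + 2 := by linarith
    have h4 := mul_le_mul_of_nonneg_left h3 hδ0.le
    rw [mul_add, mul_div_cancel₀ _ hδ0.ne'] at h4
    linarith
  have hkey : 3 * Site.supNorm z ≤ 2 ^ j * N := by
    -- `δ · 3‖z‖ ≤ 3R + 6δ < 3R + 3 ≤ 2^j (δ N)`
    have e1 : (6 * R + 6) * (δ * N) ≤ 2 ^ j * (δ * N) :=
      mul_le_mul_of_nonneg_right hT.le (by positivity)
    have e2 : (6 * R + 6) * (1 / 2) ≤ (6 * R + 6) * (δ * N) :=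
      mul_le_mul_of_nonneg_left hs.le (by positivity)
    have e3 : δ * (3 * (Site.supNorm z : ℝ)) ≤ δ * (2 ^ j * N) := by nlinarith
    have e4 : (3 * (Site.supNorm z : ℝ)) ≤ 2 ^ j * N := le_of_mul_le_mul_left e3 hδ0
    exact_mod_cast e4
  have hgN : 0 < criticalTwoPoint 3 (Pi.single 0 (N : ℤ)) := criticalTwoPoint_pos3 _
  rw [rescaledCorrelator_rhoPin_two, hNeq, le_div_iff₀ hgN]
  exact pow_mul_axis_le_criticalTwoPoint hκ hD hN1 hkey

/-! ### Part (a): local bounds at every order -/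

/-- **Local bounds for the pinned zoom under doubling** (part (a) with `ρ★ = rhoPin`): for every `n`
and compact `K ⊆ NonCoincident 3 n` there are `M`, `δ₀ > 0` with `|F_n^δ(x)| ≤ M` for
`δ ∈ (0, δ₀)`, `x ∈ K`. Odd `n`: identically `0`. Even `n = 2m`: `0 ≤ ⟨∏σ⟩ ≤ 𝒢_m[⟨σσ⟩]`
(Griffiths I; Newman's Gaussian inequality `criticalCorr_le_pairingSum`), the rescaled pairing
functional is the pairing functional of the pinned pair zooms `ρ★²⟨σ_{[xᵢ/δ]}σ_{[xⱼ/δ]}⟩` (`i ≠ j`),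
each `≤ B₂` on `K` for `δ < δ₀` (`pair_upper` on the compact pair-sets `{(xᵢ,xⱼ) : x ∈ K}`), whence
the bound `(2m)! B₂ᵐ`. [cite: AizenmanDuminilCopinAnnals2021, arXiv:1912.07973 §6.3, first display, lower inequality (p. 26)] -/
theorem locallyBounded {κ : ℝ} (hκ : 0 < κ)
    (hD : ∀ n : ℕ, 1 ≤ n → κ * criticalTwoPoint 3 (Pi.single 0 (n : ℤ)) ≤
      criticalTwoPoint 3 (Pi.single 0 (2 * (n : ℤ))))
    (n : ℕ) {K : Set (Fin n → EuclideanSpace ℝ (Fin 3))} (hK : IsCompact K)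
    (hKs : K ⊆ NonCoincident 3 n) :
    ∃ M δ₀ : ℝ, 0 < δ₀ ∧ ∀ δ ∈ Set.Ioo 0 δ₀, ∀ x ∈ K,
      |rescaledCorrelator (criticalCorr 3) rhoPin n δ x| ≤ M := by
  rcases Nat.even_or_odd n with hn | hn
  swap
  · -- odd orders vanish identically
    refine ⟨0, 1, one_pos, fun δ _ x _ => ?_⟩
    rw [rescaledCorrelator_apply, criticalCorr_eq_zero_of_odd (d := 3) le_rfl hn, mul_zero, abs_zero]
  obtain ⟨m, hm⟩ := hn
  rw [← two_mul] at hm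
  subst hm
  -- the rescaled pair kernel at the level of indices (diagonal zeroed), as an opaque function
  obtain ⟨T, hT⟩ : ∃ T : ℝ → (Fin (2 * m) → EuclideanSpace ℝ (Fin 3)) → Fin (2 * m) → Fin (2 * m) → ℝ,
      ∀ δ x i j, T δ x i j = if i = j then 0 else
        rhoPin δ ^ 2 * criticalCorr 3 2 ![latticeApprox δ (x i), latticeApprox δ (x j)] :=
    ⟨fun δ x i j => if i = j then 0 else
        rhoPin δ ^ 2 * criticalCorr 3 2 ![latticeApprox δ (x i), latticeApprox δ (x j)],
      fun _ _ _ _ => rfl⟩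
  have hTeq : ∀ δ x i j, i ≠ j →
      T δ x i j = rescaledCorrelator (criticalCorr 3) rhoPin 2 δ ![x i, x j] := by
    intro δ x i j hij
    rw [hT, if_neg hij, rescaledCorrelator_apply, latticeApprox_comp_two]
    rfl
  have hT0 : ∀ δ x i j, 0 ≤ T δ x i j := fun δ x i j => by
    rw [hT]
    split_ifs
    exacts [le_rfl, mul_nonneg (sq_nonneg _) (criticalCorr_two_nonneg _ _)]
  -- bounds for each entry, from the pair zoom on the compact pair-sets `{(xᵢ, xⱼ) : x ∈ K}`
  have hpair : ∀ ij : Fin (2 * m) × Fin (2 * m), ∃ B δ₁ : ℝ, 0 < δ₁ ∧ ∀ δ ∈ Set.Ioo 0 δ₁, ∀ x ∈ K,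
      T δ x ij.1 ij.2 ≤ B := by
    rintro ⟨i, j⟩
    show ∃ B δ₁ : ℝ, 0 < δ₁ ∧ ∀ δ ∈ Set.Ioo 0 δ₁, ∀ x ∈ K, T δ x i j ≤ B
    by_cases hij : i = j
    · refine ⟨0, 1, one_pos, fun δ _ x _ => ?_⟩
      rw [hT, if_pos hij]
    · have hcont : Continuous fun x : Fin (2 * m) → EuclideanSpace ℝ (Fin 3) =>
          (![x i, x j] : Fin 2 → EuclideanSpace ℝ (Fin 3)) :=
        (continuous_apply i).matrixVecCons ((continuous_apply j).matrixVecCons continuous_const)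
      have hPs : (fun x : Fin (2 * m) → EuclideanSpace ℝ (Fin 3) =>
          (![x i, x j] : Fin 2 → EuclideanSpace ℝ (Fin 3))) '' K ⊆ NonCoincident 3 2 := by
        rintro _ ⟨x, hx, rfl⟩
        exact pair_mem_nonCoincident fun h => hij ((mem_nonCoincident x).1 (hKs hx) h)
      obtain ⟨B, δ₁, hδ₁, hB⟩ := pair_upper hκ hD (hK.image hcont) hPs
      refine ⟨B, δ₁, hδ₁, fun δ hδ x hx => ?_⟩
      rw [hTeq δ x i j hij]
      exact hB δ hδ _ (Set.mem_image_of_mem _ hx)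
  choose B δ₁ hδ₁ hB using hpair
  obtain ⟨B₂, hBle⟩ : ∃ B₂ : ℝ, ∀ ij, B ij ≤ B₂ :=
    ⟨∑ ij, max (B ij) 0, fun ij => (le_max_left _ _).trans (Finset.single_le_sum
      (f := fun ij => max (B ij) 0) (fun ij _ => le_max_right _ _) (Finset.mem_univ ij))⟩
  -- a common mesh threshold `δ₀ = (1 + Σ δ₁⁻¹)⁻¹ ≤ δ₁ ij`
  have hS : 0 ≤ ∑ ij, (δ₁ ij)⁻¹ := Finset.sum_nonneg fun ij _ => (inv_pos.2 (hδ₁ ij)).le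
  have hδ₀ : 0 < (1 + ∑ ij, (δ₁ ij)⁻¹)⁻¹ := inv_pos.2 (by linarith)
  have hδ₀le : ∀ ij, (1 + ∑ ij, (δ₁ ij)⁻¹)⁻¹ ≤ δ₁ ij := fun ij =>
    inv_le_of_inv_le₀ (hδ₁ ij) ((Finset.single_le_sum (f := fun ij => (δ₁ ij)⁻¹)
      (fun ij _ => (inv_pos.2 (hδ₁ ij)).le) (Finset.mem_univ ij)).trans (by linarith))
  refine ⟨(2 * m).factorial * B₂ ^ m, (1 + ∑ ij, (δ₁ ij)⁻¹)⁻¹, hδ₀, fun δ hδ x hx => ?_⟩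
  have hTB : ∀ i j, T δ x i j ≤ B₂ := fun i j =>
    (hB (i, j) δ ⟨hδ.1, hδ.2.trans_le (hδ₀le (i, j))⟩ x hx).trans (hBle (i, j))
  -- index-level rescaling identity
  have hP : pairingSum (T δ x) m id = (rhoPin δ ^ 2) ^ m *
      pairingSum (fun a b => criticalCorr 3 2 ![a, b]) m (fun i => latticeApprox δ (x i)) :=
    PairIsing.pairingSum_eq_pow_mul (fun a b => criticalCorr 3 2 ![a, b]) (T δ x) (rhoPin δ ^ 2) m
      (fun i => latticeApprox δ (x i)) id fun i j hij => by
        simp only [hT, id_eq, if_neg hij]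
  have hF : rescaledCorrelator (criticalCorr 3) rhoPin (2 * m) δ x =
      (rhoPin δ ^ 2) ^ m * criticalCorr 3 (2 * m) (fun i => latticeApprox δ (x i)) := by
    rw [rescaledCorrelator_apply, pow_mul]
  have hρ : 0 ≤ (rhoPin δ ^ 2) ^ m := pow_nonneg (sq_nonneg _) m
  have hnn : 0 ≤ criticalCorr 3 (2 * m) (fun i => latticeApprox δ (x i)) :=
    Theorems.GapForcesFarMerging.Negative.criticalCorr_nonneg' _
  rw [hF, abs_of_nonneg (mul_nonneg hρ hnn)]
  calc (rhoPin δ ^ 2) ^ m * criticalCorr 3 (2 * m) (fun i => latticeApprox δ (x i))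
      ≤ (rhoPin δ ^ 2) ^ m *
          pairingSum (fun a b => criticalCorr 3 2 ![a, b]) m (fun i => latticeApprox δ (x i)) :=
        mul_le_mul_of_nonneg_left (criticalCorr_le_pairingSum m _) hρ
    _ = pairingSum (T δ x) m id := hP.symm
    _ ≤ (2 * m).factorial * B₂ ^ m := pairingSum_le_factorial_mul_pow (hT0 δ x) hTB m id

/-! ### The item -/

/-- **Item stmt-CriticalPhenomena-6157 (`RescaledBounds`) of route MirrorHoelderCompactness, proved.**
Granted all-scale doubling (D) of the axial critical two-point function on `ℤ³`, the rescaled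
critical correlators with the forced renormalisation `ρ★(δ) = ⟨σ₀σ_{⌊1/δ⌋e₀}⟩_{β_c}^{-1/2}` are
(a) locally bounded on compacts of non-coincident configurations, uniformly for small `δ`, at every
order `n` (Newman's Gaussian inequality + the pair bound), and (c) at `n = 2` bounded below by a
positive constant on compacts, uniformly for small `δ` (MMS + doubling). Parts (a) and (c) of the
shared milestone `UniformRegularity` (item 4658). [cite: MessagerMiracleSoleJSP1977, Theorem (monotonicity of ⟨σ₀σ_x⟩ under reflections)] -/
theorem rescaledBounds_proof : RescaledBounds := by
  rintro ⟨κ, hκ, hD⟩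
  refine ⟨fun n K hKs hK => ?_, fun K _ hK => ?_⟩
  · rw [rhoStar_eq_rhoPin]
    exact locallyBounded hκ hD n hK hKs
  · rw [rhoStar_eq_rhoPin]
    exact pair_lower hκ hD hK

end Summit.CriticalPhenomena.Ising3DConformalLimit.MirrorHoelderCompactnessRescaledBounds

end
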